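import Summits.Ventures.LatticeQCDFlow.Scaling.HubChainStartContentDeficitAbove
import Summits.Ventures.LatticeQCDFlow.Scaling.HubClassStartContentCoverEnum

/-!
HONEST FRAMING: exact (Metropolis-corrected) sampling algorithms for lattice gauge theory; figures
of merit are autocorrelation/cost numbers at stated couplings and volumes; no continuum-physics
claim.

# HubClassStartContentDeficitEnum — THE SHARP START-CONTENT DEFICIT BOUNDS IN CHAPTER W'S LANGUAGE (GIVEN A COMMON SORTED ENUMERATION AND THE TWO RANKS): FOR THE HUB KERNELS OF TWO
# PROFILES DEEPENING ONE CONTENT `t` OF WEIGHT `1`, WITH `γ = Kh_X(N;z,z) − Kh_Y(N;z,z)`, `q = max{0, N(z)/K − Kh_X(N;z,z)}`: (A) DEEP START, THREE PARTICLES AT OR ABOVE IT: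
# `e_{n+1} ≤ 𝟙{n odd}·γqⁿ`, `Σ_{n<J}(1−σ)σⁿe⁺_{n+1} ≤ (1−σ)γσq/(1−σ²q²)`; (B) RESIDUAL PAIR: `e_{n+1} ≤ 𝟙{n odd}K^{−(n+1)}α/(1+α)`, `α = W^X_z/W^X_t`, AND ITS SUM; (C) SHALLOW START,
# THREE PARTICLES AT OR ABOVE THE TAG: NO DEFICIT; (D) START ALONE ABOVE THE TAG: `e_{n+1} ≤ 𝟙{n even}K^{−(n+1)}t/(1+t)`, `t = W^Y_t/W^X_z`, AND ITS SUM (lean-2 GEN-41, ours)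

Venture-side (OURS).  Cell `lqcd-flow` (pub-lqcd), unit `pub-lqcd-lean-2-g41`, 2026-08-30.  Chapter AA (route (β), the cost side), file 5 = files 1–3 moved to chapter W's hub kernel
`Kh(N;h,v) = 𝟙{N(h)≠0}(N(v)/K)min{1,W_h/W_v}` on a finite content type exactly as Z11 moved Σ (same hypotheses: two persistence profiles agreeing off a present content `t`,
`N(t) = 1`, `W^Y_t ≤ W^X_t`, `ΣN = K+1`, `K ≥ 2`, a common enumeration `e` of the present contents sorted for both profiles; here the ranks `i` of `z` and `s` of `t` are named in the
hypotheses, the configuration being read off them).  The `ℕ`-indexed kernels are built from the enumeration and identified with `Kh`, `Khⁿ` through Y12 (verbatim from Z11); the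
eigenvalue data become KERNEL data: `β^X_i − β^Y_i = Kh_X(N;z,z) − Kh_Y(N;z,z)` (file 1 `sharp_diag_sub`), `−β^X_i = N(z)/K − Kh_X(N;z,z)` (Y7 `hubClass_diag`), `ρ^X_0/ρ_1 = W^X_z/W^X_t`.

* **`hubClass_startClass_deficit_of_enum`**: the conjunction (A) ∧ (B) ∧ (C) ∧ (D) of the module title (file 1 `sharp_deficit_even`∕`_odd`, file 3 `sharp_deficit_discounted`; file 2
  `residual_deficit_even`∕`_odd`, file 3 `residual_deficit_discounted`; Z2 `perStep_pow_diag_le`; file 9 `above_deficit_odd_step`∕`_even_step`∕`_discounted`).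

File 6 instantiates W26's tagged chains (no content strictly between the two extra particles).  Literature grade (cell rule): OWN, plumbing; nothing cited; no new bib keys.
-/

open Finset

namespace Summit.Ventures.LatticeQCDFlow.Scaling

section DeficitEnum
variable {S : Type*} [Fintype S] [DecidableEq S]

/-- **The sharp start-content deficit bounds given a common sorted enumeration and the ranks** (see the module docstring). [ours] -/
theorem hubClass_startClass_deficit_of_enum {WX WY : S → ℝ} {accX accY : S → S → ℝ} {KhX KhY : (S → ℕ) → S → S → ℝ} {K : ℕ} {N : S → ℕ} {t z : S}
    {KhnX KhnY : ℕ → S → S → ℝ} {e : ℕ → S} {m i s : ℕ}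
    (hWX : ∀ v, 0 < WX v) (hWY : ∀ v, 0 < WY v) (hagree : ∀ v, v ≠ t → WX v = WY v) (hWt : WY t ≤ WX t)
    (haccX : ∀ h v, accX h v = min 1 (WX h / WX v)) (haccY : ∀ h v, accY h v = min 1 (WY h / WY v)) (hK : 2 ≤ K)
    (hNK : ∑ v, (N v : ℝ) = K + 1) (hNt : N t = 1)
    (hKXoff : ∀ N' h v, h ≠ v → KhX N' h v = if N' h = 0 then 0 else (N' v : ℝ) / K * accX h v)
    (hKXdiag : ∀ N' h, KhX N' h h = 1 - ∑ v ∈ univ.erase h, KhX N' h v)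
    (hKYoff : ∀ N' h v, h ≠ v → KhY N' h v = if N' h = 0 then 0 else (N' v : ℝ) / K * accY h v)
    (hKYdiag : ∀ N' h, KhY N' h h = 1 - ∑ v ∈ univ.erase h, KhY N' h v)
    (hKhnX0 : ∀ h v, KhnX 0 h v = if h = v then 1 else 0) (hKhnXs : ∀ n h v, KhnX (n + 1) h v = ∑ w, KhnX n h w * KhX N w v)
    (hKhnY0 : ∀ h v, KhnY 0 h v = if h = v then 1 else 0) (hKhnYs : ∀ n h v, KhnY (n + 1) h v = ∑ w, KhnY n h w * KhY N w v)
    (he_inj : ∀ i j, i < m → j < m → e i = e j → i = j) (he_pres : ∀ i, i < m → N (e i) ≠ 0) (he_cov : ∀ v, N v ≠ 0 → ∃ i, i < m ∧ e i = v)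
    (hsortX : ∀ i j, i ≤ j → j < m → WX (e j) ≤ WX (e i)) (hsortY : ∀ i j, i ≤ j → j < m → WY (e j) ≤ WY (e i))
    (hi : i < m) (hs : s < m) (hiz : e i = z) (hst : e s = t) (his : i ≠ s) :
    (s < i → (3 : ℝ) ≤ ∑ l ∈ range (i + 1), (N (e l) : ℝ) →
        (∀ n, KhnY (n + 1) z z - KhnX (n + 1) z z
            ≤ (if Odd n then (KhX N z z - KhY N z z) * (max 0 ((N z : ℝ) / K - KhX N z z)) ^ n else 0))
        ∧ (∀ σ : ℝ, 0 ≤ σ → σ ≤ 1 → ∀ J, ∑ n ∈ range J, (1 - σ) * σ ^ n * max 0 (KhnY (n + 1) z z - KhnX (n + 1) z z)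
            ≤ (1 - σ) * ((KhX N z z - KhY N z z) * (σ * max 0 ((N z : ℝ) / K - KhX N z z) / (1 - (σ * max 0 ((N z : ℝ) / K - KhX N z z)) ^ 2)))))
    ∧ (s = 0 → i = 1 → N z = 1 →
        (∀ n, KhnY (n + 1) z z - KhnX (n + 1) z z
            ≤ (if Odd n then (1 / (K : ℝ)) ^ (n + 1) * ((WX z / WX t) / (1 + WX z / WX t)) else 0))
        ∧ (∀ σ : ℝ, 0 ≤ σ → σ < 1 → ∀ J, ∑ n ∈ range J, (1 - σ) * σ ^ n * max 0 (KhnY (n + 1) z z - KhnX (n + 1) z z)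
            ≤ (1 - σ) * ((WX z / WX t) / (1 + WX z / WX t) * (1 / (K : ℝ)) * (σ * (1 / (K : ℝ)) / (1 - (σ * (1 / (K : ℝ))) ^ 2)))))
    ∧ (i < s → (3 : ℝ) ≤ ∑ l ∈ range (s + 1), (N (e l) : ℝ) → ∀ n, KhnY n z z ≤ KhnX n z z)
    ∧ (i = 0 → s = 1 → N z = 1 →
        (∀ n, KhnY (n + 1) z z - KhnX (n + 1) z z
            ≤ (if Even n then (1 / (K : ℝ)) ^ (n + 1) * ((WY t / WX z) / (1 + WY t / WX z)) else 0))
        ∧ (∀ σ : ℝ, 0 ≤ σ → σ < 1 → ∀ J, ∑ n ∈ range J, (1 - σ) * σ ^ n * max 0 (KhnY (n + 1) z z - KhnX (n + 1) z z)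
            ≤ (1 - σ) * ((WY t / WX z) / (1 + WY t / WX z) * (1 / (K : ℝ)) * ((σ * (1 / (K : ℝ))) ^ 2 / (1 - (σ * (1 / (K : ℝ))) ^ 2))))) := by
  classical
  subst hiz; subst hst
  have hNt0 : N (e s) ≠ 0 := by rw [hNt]; exact one_ne_zero
  have hK1 : 1 ≤ K := by omega
  have hWXY : ∀ v, WY v ≤ WX v := fun v => by
    by_cases hv : v = e s
    · rw [hv]; exact hWt
    · rw [hagree v hv]
  have het : ∀ l, l < m → l ≠ s → e l ≠ e s := fun l hl hls h => hls (he_inj l s hl hs h)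
  -- the `ℕ`-indexed data (verbatim from Z11)
  obtain ⟨c, hc⟩ : ∃ c : ℝ, c = 1 / K := ⟨_, rfl⟩
  obtain ⟨ρX, hρX⟩ : ∃ ρX : ℕ → ℝ, ∀ l, ρX l = if l < m then 1 / WX (e l) else 1 / WY (e (m - 1)) := ⟨_, fun _ => rfl⟩
  obtain ⟨ρY, hρY⟩ : ∃ ρY : ℕ → ℝ, ∀ l, ρY l = if l < m then 1 / WY (e l) else 1 / WY (e (m - 1)) := ⟨_, fun _ => rfl⟩
  obtain ⟨Nn, hNn⟩ : ∃ Nn : ℕ → ℝ, ∀ l, Nn l = if l < m then (N (e l) : ℝ) else 1 := ⟨_, fun _ => rfl⟩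
  obtain ⟨RX, hRX⟩ : ∃ RX : ℕ → ℝ, ∀ k, RX k = ∑ i ∈ range k, Nn i * ρX i := ⟨_, fun _ => rfl⟩
  obtain ⟨RY, hRY⟩ : ∃ RY : ℕ → ℝ, ∀ k, RY k = ∑ i ∈ range k, Nn i * ρY i := ⟨_, fun _ => rfl⟩
  obtain ⟨M, hM⟩ : ∃ M : ℕ → ℝ, ∀ k, M k = ∑ i ∈ Ico k m, Nn i := ⟨_, fun _ => rfl⟩
  obtain ⟨βX, hβX⟩ : ∃ βX : ℕ → ℝ, ∀ k, βX k = 1 - c * (M k + RX k / ρX k) := ⟨_, fun _ => rfl⟩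
  obtain ⟨βY, hβY⟩ : ∃ βY : ℕ → ℝ, ∀ k, βY k = 1 - c * (M k + RY k / ρY k) := ⟨_, fun _ => rfl⟩
  obtain ⟨a, ha⟩ : ∃ a : ℕ → ℝ, ∀ l, a l = 1 - c * M (l + 1) := ⟨_, fun _ => rfl⟩
  obtain ⟨TX, hTX⟩ : ∃ TX : ℕ → ℕ → ℝ, ∀ n j, TX n j = (1 - βX j ^ n) / RX m + ∑ k ∈ Ico (j + 1) m, (1 / RX k - 1 / RX (k + 1)) * (βX k ^ n - βX j ^ n) :=
    ⟨_, fun _ _ => rfl⟩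
  obtain ⟨TY, hTY⟩ : ∃ TY : ℕ → ℕ → ℝ, ∀ n j, TY n j = (1 - βY j ^ n) / RY m + ∑ k ∈ Ico (j + 1) m, (1 / RY k - 1 / RY (k + 1)) * (βY k ^ n - βY j ^ n) :=
    ⟨_, fun _ _ => rfl⟩
  obtain ⟨fX, hfX⟩ : ∃ fX : ℕ → ℕ → ℝ, ∀ k i, fX k i = if i < k then ρX k else if i = k then -(RX k / Nn k) else 0 := ⟨_, fun _ _ => rfl⟩
  obtain ⟨fY, hfY⟩ : ∃ fY : ℕ → ℕ → ℝ, ∀ k i, fY k i = if i < k then ρY k else if i = k then -(RY k / Nn k) else 0 := ⟨_, fun _ _ => rfl⟩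
  obtain ⟨offX, hoffX⟩ : ∃ off : ℕ → ℕ → ℝ, ∀ i j, off i j = c * Nn j * min 1 (ρX j / ρX i) := ⟨_, fun _ _ => rfl⟩
  obtain ⟨offY, hoffY⟩ : ∃ off : ℕ → ℕ → ℝ, ∀ i j, off i j = c * Nn j * min 1 (ρY j / ρY i) := ⟨_, fun _ _ => rfl⟩
  obtain ⟨PX, hPX⟩ : ∃ P : ℕ → ℕ → ℝ, ∀ i j, P i j = if i = j then 1 - ∑ l ∈ (range m).erase i, offX i l else offX i j := ⟨_, fun _ _ => rfl⟩
  obtain ⟨PY, hPY⟩ : ∃ P : ℕ → ℕ → ℝ, ∀ i j, P i j = if i = j then 1 - ∑ l ∈ (range m).erase i, offY i l else offY i j := ⟨_, fun _ _ => rfl⟩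
  have hPXoff : ∀ i j, i ≠ j → PX i j = c * Nn j * min 1 (ρX j / ρX i) := fun i j h => by rw [hPX, if_neg h, hoffX]
  have hPYoff : ∀ i j, i ≠ j → PY i j = c * Nn j * min 1 (ρY j / ρY i) := fun i j h => by rw [hPY, if_neg h, hoffY]
  have hPXdiag : ∀ i, PX i i = 1 - ∑ j ∈ (range m).erase i, PX i j := fun i => by
    rw [hPX, if_pos rfl]; congr 1; exact sum_congr rfl fun j hj => by rw [hPX, if_neg (ne_of_mem_erase hj).symm]
  have hPYdiag : ∀ i, PY i i = 1 - ∑ j ∈ (range m).erase i, PY i j := fun i => by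
    rw [hPY, if_pos rfl]; congr 1; exact sum_congr rfl fun j hj => by rw [hPY, if_neg (ne_of_mem_erase hj).symm]
  let PnX : ℕ → ℕ → ℕ → ℝ := fun n => Nat.rec (motive := fun _ => ℕ → ℕ → ℝ) (fun i j => if i = j then 1 else 0) (fun _ prev i j => ∑ l ∈ range m, prev i l * PX l j) n
  let PnY : ℕ → ℕ → ℕ → ℝ := fun n => Nat.rec (motive := fun _ => ℕ → ℕ → ℝ) (fun i j => if i = j then 1 else 0) (fun _ prev i j => ∑ l ∈ range m, prev i l * PY l j) n
  have hPX0 : ∀ i j, PnX 0 i j = if i = j then 1 else 0 := fun _ _ => rfl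
  have hPXs : ∀ n i j, PnX (n + 1) i j = ∑ l ∈ range m, PnX n i l * PX l j := fun _ _ _ => rfl
  have hPY0 : ∀ i j, PnY 0 i j = if i = j then 1 else 0 := fun _ _ => rfl
  have hPYs : ∀ n i j, PnY (n + 1) i j = ∑ l ∈ range m, PnY n i l * PY l j := fun _ _ _ => rfl
  -- elementary facts (verbatim from Z11)
  have hρXpos : ∀ l, 0 < ρX l := fun l => by rw [hρX]; split_ifs <;> exact one_div_pos.mpr (by first | exact hWX _ | exact hWY _)
  have hρYpos : ∀ l, 0 < ρY l := fun l => by rw [hρY]; split_ifs <;> exact one_div_pos.mpr (hWY _)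
  have hNnpos : ∀ l, 0 < Nn l := fun l => by
    rw [hNn]; split_ifs with h
    · exact_mod_cast Nat.pos_of_ne_zero (he_pres l h)
    · exact one_pos
  have hNn1 : ∀ l, 1 ≤ Nn l := fun l => by
    rw [hNn]; split_ifs with h
    · exact_mod_cast Nat.one_le_iff_ne_zero.mpr (he_pres l h)
    · exact le_rfl
  have hmonoX : Monotone ρX := by
    intro l l' hll'
    rw [hρX, hρX]
    by_cases hl' : l' < m
    · rw [if_pos hl', if_pos (by omega : l < m)]; exact one_div_le_one_div_of_le (hWX _) (hsortX l l' hll' hl')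
    · rw [if_neg hl']
      by_cases hl : l < m
      · rw [if_pos hl]; exact one_div_le_one_div_of_le (hWY _) ((hWXY _).trans (hsortX l (m - 1) (by omega) (by omega)))
      · rw [if_neg hl]
  have hmonoY : Monotone ρY := by
    intro l l' hll'
    rw [hρY, hρY]
    by_cases hl' : l' < m
    · rw [if_pos hl', if_pos (by omega : l < m)]; exact one_div_le_one_div_of_le (hWY _) (hsortY l l' hll' hl')
    · rw [if_neg hl']
      by_cases hl : l < m
      · rw [if_pos hl]; exact one_div_le_one_div_of_le (hWY _) (hsortY l (m - 1) (by omega) (by omega))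
      · rw [if_neg hl]
  have hagree' : ∀ l, l ≠ s → ρX l = ρY l := by
    intro l hls
    rw [hρX, hρY]
    by_cases hl : l < m
    · rw [if_pos hl, if_pos hl, hagree (e l) (het l hl hls)]
    · rw [if_neg hl, if_neg hl]
  have htag' : ρX s ≤ ρY s := by
    rw [hρX, hρY, if_pos hs, if_pos hs]; exact one_div_le_one_div_of_le (hWY _) hWt
  have hKpos : (0 : ℝ) < K := by exact_mod_cast (show 0 < K by omega)
  have hcpos : 0 < c := by rw [hc]; positivity
  have hc1 : c ≤ 1 := by rw [hc, div_le_one hKpos]; exact_mod_cast hK1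
  have hM0 : M 0 = ∑ v, (N v : ℝ) := by
    rw [hM, dict_sum_present he_inj he_cov (F := fun v => (N v : ℝ)) (fun v hv => by simp [hv])]
    refine sum_congr (by ext l; simp) fun l hl => ?_
    rw [hNn, if_pos (mem_range.mp hl)]
  have hcK : c * M 0 = 1 + c := by rw [hM0, hNK, hc]; field_simp
  -- the kernel link on the ranks `< m` (verbatim from Z11)
  have hlinkX : ∀ l j, l < m → j < m → KhX N (e l) (e j) = PX l j := by
    intro l j hl hj
    by_cases hlj : l = j
    · subst hlj
      rw [dict_Kh_diag hKXoff hKXdiag he_inj he_pres he_cov hl, hPXdiag]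
      congr 1
      refine sum_congr rfl fun j hj' => ?_
      have hjm : j < m := mem_range.mp (mem_of_mem_erase hj')
      rw [dict_Kh_offdiag hWX haccX hKXoff he_inj he_pres hl hjm (ne_of_mem_erase hj').symm, hPXoff l j (ne_of_mem_erase hj').symm, hNn, if_pos hjm, hρX, hρX, if_pos hjm, if_pos hl, hc]
    · rw [dict_Kh_offdiag hWX haccX hKXoff he_inj he_pres hl hj hlj, hPXoff l j hlj, hNn, if_pos hj, hρX, hρX, if_pos hj, if_pos hl, hc]
  have hlinkY : ∀ l j, l < m → j < m → KhY N (e l) (e j) = PY l j := by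
    intro l j hl hj
    by_cases hlj : l = j
    · subst hlj
      rw [dict_Kh_diag hKYoff hKYdiag he_inj he_pres he_cov hl, hPYdiag]
      congr 1
      refine sum_congr rfl fun j hj' => ?_
      have hjm : j < m := mem_range.mp (mem_of_mem_erase hj')
      rw [dict_Kh_offdiag hWY haccY hKYoff he_inj he_pres hl hjm (ne_of_mem_erase hj').symm, hPYoff l j (ne_of_mem_erase hj').symm, hNn, if_pos hjm, hρY, hρY, if_pos hjm, if_pos hl, hc]
    · rw [dict_Kh_offdiag hWY haccY hKYoff he_inj he_pres hl hj hlj, hPYoff l j hlj, hNn, if_pos hj, hρY, hρY, if_pos hj, if_pos hl, hc]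
  have hpowX : ∀ n l j, l < m → j < m → KhnX n (e l) (e j) = PnX n l j := by
    intro n; induction n with
    | zero =>
        intro l j hl hj
        rw [hKhnX0, hPX0]
        by_cases h : l = j
        · rw [if_pos (by rw [h]), if_pos h]
        · rw [if_neg (fun h' => h (he_inj l j hl hj h')), if_neg h]
    | succ n ih =>
        intro l j hl hj
        rw [dict_Khn_succ hKXoff he_inj he_pres he_cov hKhnX0 hKhnXs n hl hj, hPXs]
        exact sum_congr rfl fun k hk => by rw [ih l k hl (mem_range.mp hk), hlinkX k j (mem_range.mp hk) hj]
  have hpowY : ∀ n l j, l < m → j < m → KhnY n (e l) (e j) = PnY n l j := by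
    intro n; induction n with
    | zero =>
        intro l j hl hj
        rw [hKhnY0, hPY0]
        by_cases h : l = j
        · rw [if_pos (by rw [h]), if_pos h]
        · rw [if_neg (fun h' => h (he_inj l j hl hj h')), if_neg h]
    | succ n ih =>
        intro l j hl hj
        rw [dict_Khn_succ hKYoff he_inj he_pres he_cov hKhnY0 hKhnYs n hl hj, hPYs]
        exact sum_congr rfl fun k hk => by rw [ih l k hl (mem_range.mp hk), hlinkY k j (mem_range.mp hk) hj]
  -- particle counts
  have hMsplit : ∀ k, k < m → M 0 = ∑ l ∈ range (k + 1), Nn l + M (k + 1) := fun k hk => by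
    rw [hM, hM, ← Finset.range_eq_Ico]; exact (Finset.sum_range_add_sum_Ico _ (by omega : k + 1 ≤ m)).symm
  have hcountN : ∀ k, k < m → ∑ l ∈ range (k + 1), Nn l = ∑ l ∈ range (k + 1), (N (e l) : ℝ) := fun k hk =>
    sum_congr rfl fun l hl => by rw [hNn, if_pos (by have := mem_range.mp hl; omega)]
  -- the kernel data at the start class: `β^X_i − β^Y_i = Kh_X(z,z) − Kh_Y(z,z)`, `−β^X_i = N(z)/K − Kh_X(z,z)`
  have hγ : βX i - βY i = KhX N (e i) (e i) - KhY N (e i) (e i) := by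
    rw [hlinkX i i hi hi, hlinkY i i hi hi]
    exact (sharp_diag_sub hρXpos hmonoX hρYpos hmonoY hRX hRY hM hPXoff hPXdiag hPYoff hPYdiag hβX hβY hi).symm
  have hq : -βX i = (N (e i) : ℝ) / K - KhX N (e i) (e i) := by
    rw [hlinkX i i hi hi, hubClass_diag hρXpos hmonoX hRX hM hPXoff hPXdiag hβX hi, hNn, if_pos hi, hc]
    ring
  refine ⟨fun hsi h3 => ?_, fun hs0 hi1 hNz => ?_, fun his' h3 => ?_, fun hi0 hs1 hNz => ?_⟩
  · -- (A) deep start, three particles at ranks `≤ i`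
    have h3' : M (i + 1) + 3 ≤ M 0 := by rw [hMsplit i hi, hcountN i hi]; linarith
    refine ⟨fun n => ?_, fun σ hσ0 hσ1 J => ?_⟩
    · rw [hpowY (n + 1) i i hi hi, hpowX (n + 1) i i hi hi, ← hγ, ← hq]
      rcases Nat.even_or_odd n with hev | hod
      · rw [if_neg (Nat.not_odd_iff_even.mpr hev)]
        exact sharp_deficit_odd hρXpos hmonoX hρYpos hmonoY hagree' htag' hNnpos hRX hRY hM hPXoff hPXdiag hPYoff hPYdiag hfX hfY hβX hβY ha hPX0 hPXs hPY0 hPYs hTX hTY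
          hcpos.le hcK.le hev.add_one hsi hi h3'
      · rw [if_pos hod]
        exact sharp_deficit_even hρXpos hmonoX hρYpos hmonoY hagree' htag' hNnpos hRX hRY hM hPXoff hPXdiag hPYoff hPYdiag hfX hfY hβX hβY ha hPX0 hPXs hPY0 hPYs hTX hTY
          hcpos.le hcK.le hod hsi hi h3' (hNn1 i)
    · have h := sharp_deficit_discounted hρXpos hmonoX hρYpos hmonoY hagree' htag' hNnpos hRX hRY hM hPXoff hPXdiag hPYoff hPYdiag hfX hfY hβX hβY ha hPX0 hPXs hPY0 hPYs hTX hTY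
        hcpos.le hcK.le hsi hi h3' (hNn1 i) hσ0 hσ1 J
      rw [← hγ, ← hq]
      refine le_trans (le_of_eq (sum_congr rfl fun n _ => ?_)) h
      rw [hpowY (n + 1) i i hi hi, hpowX (n + 1) i i hi hi]
  · -- (B) the residual pair `(s,i) = (0,1)`
    subst hs0; subst hi1
    have hN0' : Nn 0 = 1 := by rw [hNn, if_pos hs, hNt]; simp
    have hN1' : Nn 1 = 1 := by rw [hNn, if_pos hi, hNz]; simp
    have hα : ρX 0 / ρX 1 = WX (e 1) / WX (e 0) := by
      rw [hρX, hρX, if_pos hs, if_pos hi]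
      have h0 := hWX (e 0); have h1 := hWX (e 1)
      field_simp
    refine ⟨fun n => ?_, fun σ hσ0 hσ1 J => ?_⟩
    · rw [hpowY (n + 1) 1 1 hi hi, hpowX (n + 1) 1 1 hi hi, ← hα, ← hc]
      rcases Nat.even_or_odd n with hev | hod
      · rw [if_neg (Nat.not_odd_iff_even.mpr hev)]
        exact residual_deficit_odd hρXpos hmonoX hρYpos hmonoY hagree' htag' hNnpos hNn1 hRX hRY hM hPXoff hPXdiag hPYoff hPYdiag hfX hfY hβX hβY ha hPX0 hPXs hPY0 hPYs hTX hTY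
          hcpos.le hcK hN0' hN1' hi hev.add_one
      · rw [if_pos hod]
        exact residual_deficit_even hρXpos hmonoX hρYpos hmonoY hagree' htag' hNnpos hNn1 hRX hRY hM hPXoff hPXdiag hPYoff hPYdiag hfX hfY hβX hβY ha hPX0 hPXs hPY0 hPYs hTX hTY
          hcpos.le hcK hN0' hN1' hi hod.add_one
    · have h := residual_deficit_discounted hρXpos hmonoX hρYpos hmonoY hagree' htag' hNnpos hNn1 hRX hRY hM hPXoff hPXdiag hPYoff hPYdiag hfX hfY hβX hβY ha hPX0 hPXs hPY0 hPYs
        hTX hTY hcpos.le hc1 hcK hN0' hN1' hi hσ0 hσ1 J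
      rw [← hα, ← hc]
      refine le_trans (le_of_eq (sum_congr rfl fun n _ => ?_)) h
      rw [hpowY (n + 1) 1 1 hi hi, hpowX (n + 1) 1 1 hi hi]
  · -- (C) shallow start, three particles at ranks `≤ s`
    intro n
    have h3' : M (s + 1) + 3 ≤ M 0 := by rw [hMsplit s hs, hcountN s hs]; linarith
    rw [hpowY n i i hi hi, hpowX n i i hi hi]
    exact perStep_pow_diag_le hρXpos hmonoX hρYpos hmonoY hagree' htag' hNnpos hRX hRY hM hPXoff hPXdiag hPYoff hPYdiag hfX hfY hβX hβY ha hPX0 hPXs hPY0 hPYs hTX hTY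
      hcpos.le hcK.le n his' hs h3'
  · -- (D) the start class alone above the tag `(i,s) = (0,1)`
    subst hi0; subst hs1
    have hN0' : Nn 0 = 1 := by rw [hNn, if_pos hi, hNz]; simp
    have hN1' : Nn 1 = 1 := by rw [hNn, if_pos hs, hNt]; simp
    have hα : ρX 0 / ρY 1 = WY (e 1) / WX (e 0) := by
      rw [hρX, hρY, if_pos hi, if_pos hs]
      have h0 := hWX (e 0); have h1 := hWY (e 1)
      field_simp
    refine ⟨fun n => ?_, fun σ hσ0 hσ1 J => ?_⟩
    · rw [hpowY (n + 1) 0 0 hi hi, hpowX (n + 1) 0 0 hi hi, ← hα, ← hc]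
      rcases Nat.even_or_odd n with hev | hod
      · rw [if_pos hev]
        exact above_deficit_odd_step hρXpos hmonoX hρYpos hmonoY hagree' htag' hNnpos hNn1 hRX hRY hM hPXoff hPXdiag hPYoff hPYdiag hfX hfY hβX hβY ha hPX0 hPXs hPY0 hPYs hTX hTY
          hcpos.le hcK hN0' hN1' hs hev
      · rw [if_neg (Nat.not_even_iff_odd.mpr hod)]
        exact above_deficit_even_step hρXpos hmonoX hρYpos hmonoY hagree' htag' hNnpos hNn1 hRX hRY hM hPXoff hPXdiag hPYoff hPYdiag hfX hfY hβX hβY ha hPX0 hPXs hPY0 hPYs hTX hTY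
          hcpos.le hcK hN0' hN1' hs hod
    · have h := above_deficit_discounted hρXpos hmonoX hρYpos hmonoY hagree' htag' hNnpos hNn1 hRX hRY hM hPXoff hPXdiag hPYoff hPYdiag hfX hfY hβX hβY ha hPX0 hPXs hPY0 hPYs
        hTX hTY hcpos.le hc1 hcK hN0' hN1' hs hσ0 hσ1 J
      rw [← hα, ← hc]
      refine le_trans (le_of_eq (sum_congr rfl fun n _ => ?_)) h
      rw [hpowY (n + 1) 0 0 hi hi, hpowX (n + 1) 0 0 hi hi]

end DeficitEnum

end Summit.Ventures.LatticeQCDFlow.Scaling
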